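import Literature.MathematicalPhysics.QuantumFieldTheory.Balaban1983to89.B5SecondOrderGpTorus
import Literature.MathematicalPhysics.QuantumFieldTheory.Balaban1983to89.B5ResidualGpTorusHolds

/-!
# `Balaban1983to89.B9Ineq344TowerScalarEntries` — [B5] Prop. 1.2 (1.110)₃ ∕ (1.112) ∕ (1.113) for ONE level `k` of
# Bałaban's scalar torus tower, READ AS SCALAR KERNEL BOUNDS (one direction `ν`, one function `f` supported in a unit cube,
# decay factor dropped), uniformly in the volume and the level — the analytic input of row 11 of the N06 knit at `U = 1`

T. Bałaban, *Propagators and renormalization transformations for lattice gauge theories. I*, Commun. Math. Phys. **95** (1984)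
17–40 [`Balaban1984PropagatorsI`, "B5"], Prop. 1.2 (1.110), (1.112)–(1.113) p. 36 and the remark *"the choice of derivatives ∇G∇*
is accidental"*; (1.135)–(1.137) pp. 39–40; T. Bałaban, *Regularity and decay of lattice Green's functions*, Commun. Math. Phys.
**89** (1983) 571–597 [`Balaban1983RegularityDecay`], Lemma 2.4 (2.35)–(2.37) p. 582; T. Bałaban, *Propagators for lattice gauge
theories in a background field*, Commun. Math. Phys. **99** (1985) 389–434 [`Balaban1985BackgroundPropagators`, "B9"], Thm 3.1
(3.44)–(3.45) p. 398, Cor. 3.5 p. 407 (*"For … U = 1, these theorems are proved in [4]"*).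

statement-level skeleton of published theorems with citation tags; proofs where landed; nothing here is a claim about the
Yang–Mills mass gap

THE POINT.  Row 11 of the N06 knit at def-Y's instance is `⇐ B9Ineq344LocalToKIdx.LocalSecondOrderKIdx` (dag-n06-h g4): the
[B5]-Prop-1.2-type clauses of SOME comparison pair around each source block.  The comparison operator of the discharge (FILE 22,
`B9Ineq344LocalPairHolds`) is the ONE-LEVEL operator `G′_k = G_k^{resc}` of Bałaban's scalar torus tower (`B1RG242Torus.tower P a m²`,
`B5Display136Torus.Grs`) at the level `k = j′` of the source block, on the SAME torus (the V1 torus `Site P 0`, `P = PV d ℓ m K`,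
charted to p21's fundamental box by `B6GlobalChartV1.boxEquiv`).  For that operator the lit-balaban lineage PROVED Prop. 1.2:
`B5ResidualGpTorusHolds.residualGpFirst_gpFam` ((1.110)₃), `B5Leaf235Torus.ineq137_torus_leaf` ((1.112) = (1.137)),
`B5Ineq113.ineq113At_of_display136` + `B5SecondOrderGpTorus.leaf236_scaleData_torus` ((1.113) in pair form).  THIS FILE only READS those
theorems as three scalar kernel bounds with constants uniform in the volume `P` (`P.d = D`, `P.L = L`) and the level `1 ≤ k ≤ m + K`,
at `a = 1`, `m² = 0` (decay factor `e^{−δ|y−y′|} ≤ 1` dropped — row 11 needs none):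
* §1 the three family statements at the G′-setting of record `B5GpSettingTorus.gpSetting P 1 0 k (L2Half.trivial P)`:
  `supEntry2_sdata` (SupEntry 2), `ineq137_sdata` (Ineq137), ★ `ineq113At_sdata` (Ineq113At — the pair form of (1.113), assembled
  here from the printed road exactly as `B5SecondOrderGpTorus.entries_gpSetting` does for `H2Entry`);
* §2 the scalar readings: ★ `abs_E1_le` — `|(G′_k∂*_νf)(x)| ≤ C|f|`; ★ `abs_E_le` — `|(∂_μG′_k∂*_νf)(x)| ≤ C(ε)(‖f‖_ε + |f|)`
  (`0 < ε < 1`); ★ `abs_E_sub_E_le` — `|(∂_μG′_k∂*_νf)(x₁) − (∂_μG′_k∂*_νf)(x₂)| ≤ C(α,ε)(‖f‖_{α+ε} + |f|)|x₁ − x₂|^α` for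
  `|x₁ − x₂| ≤ 1` (η-units), `0 ≤ α`, `0 < ε`, `α + ε < 1`; all for `f` supported in one cube `Δ̃(y′)`, every `x`, `x₁`, `x₂`.

HONEST SCOPE.  Bookkeeping over PROVED lineage theorems (no new estimate; constants existential, functions of `D, L` and the
exponents only).  `U = 1`; nothing of [B9] asserted; count-neutral; N06 NOT discharged; one finite lattice programme — nothing
continuum, nothing about the mass gap.  Cell `pub-ymgap` (HUMAN RULING D-0062), Track A node N06 [B9], N06-ASSIGNMENT v1 row 11
(bundle F3), seat `pub-ymgap-dag-n06-h` (g5), 2026-08-27.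
-/

namespace Literature.MathematicalPhysics.QuantumFieldTheory.Balaban1983to89

open Matrix

noncomputable section

namespace B9Ineq344TowerScalarEntries

open B1RG242Torus B5Display136Torus B5Display135Torus B5Ineq137Torus B5GpSettingTorus
open B5SecondOrderGpTorus (leaf236_scaleData_torus rowZero_scaleData)
open B5Leaf235Torus (leaf235to237_torus ineq137_torus_leaf abs_aSeq_le)
open B5ResidualGpTorusHolds (GpIdx gpFam gpHolderFam residualGpFirst_gpFam)
open B5Leaf237C0Torus (decay_mono)

/-! ## §1 The three family statements at the G′-setting of record (`a = 1`, `m² = 0`) -/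

section Family

variable (D L : ℕ) (hd : 1 ≤ D) (hL : Odd L ∧ 1 < L)

include hd hL in
/-- **(1.110)₃ FOR G′_k AT EVERY LEVEL, UNIFORMLY**: one `δ > 0`, `C > 0` with `SupEntry (gpSetting P 1 0 k _) 2 C δ` —
`sup_{x∈Δ̃(y)}|(G′∇*J)(x)| ≤ Ce^{−δ|y−y′|}|J|` for `supp J ⊂ Δ̃(y′)` — for every volume `P` (`P.d = D`, `P.L = L`) and level
`1 ≤ k ≤ m + K` (`B5ResidualGpTorusHolds.residualGpFirst_gpFam`, first conjunct). [cite: Balaban1984PropagatorsI, Prop. 1.2 (1.110) p.35, (1.135) p.39] -/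
theorem supEntry2_sdata : ∃ δ C : ℝ, 0 < δ ∧ 0 < C ∧ ∀ (P : Params), P.d = D → P.L = L →
    ∀ (k : ℕ), 1 ≤ k → k ≤ P.m + P.K → B5FromB4.SupEntry (gpSetting P 1 0 k (L2Half.trivial P)) 2 C δ := by
  obtain ⟨δ₀, C, Cα, hδ₀, hC, H⟩ := residualGpFirst_gpFam D L hd hL one_pos le_rfl 0
    (fun i : GpIdx D L 0 0 => L2Half.trivial i.P)
  refine ⟨δ₀, C, hδ₀, hC, fun P hPd hPL k hk1 hkK => ?_⟩
  have hcap : P.spacing k ^ 2 * (0 : ℝ) ≤ 0 := by rw [mul_zero]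
  exact (H ⟨P, k, hPd, hPL, hk1, hkK, hcap⟩).1

include hd hL in
/-- **(1.112) = (1.137) FOR G′_k AT EVERY LEVEL, UNIFORMLY** (`B5Leaf235Torus.ineq137_torus_leaf` at the G′-setting of record,
`σ = id`): one rate and one constant function for all volumes and levels. [cite: Balaban1984PropagatorsI, (1.112) p.36, (1.135)–(1.137) pp.39–40; Balaban1983RegularityDecay, Lemma 2.4 (2.35)–(2.37) p.582] -/
theorem ineq137_sdata : ∃ δ : ℝ, ∃ Cε : ℝ → ℝ, 0 < δ ∧ (∀ ε, 0 < ε → ε < 1 → 0 ≤ Cε ε) ∧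
    ∀ (P : Params), P.d = D → P.L = L → ∀ (k : ℕ), 1 ≤ k → k ≤ P.m + P.K →
      B5Ineq137.Ineq137 (sdata 1 0 k (L2Half.trivial P) (P := P)) Cε δ := by
  obtain ⟨δ₁, c₀, hδ₁, hc₀, H137⟩ := ineq137_torus_leaf D L hd hL one_pos le_rfl 0
  have hL1 : (1 : ℝ) < (L : ℝ) := by exact_mod_cast hL.2
  refine ⟨δ₁ / 2, fun ε => 2 * ((c₀ + (1 : ℝ) ^ 2 * c₀ ^ 3 *
      (Real.exp (δ₁ / 4) * B4Sect5Proof.latticeConst D (δ₁ / 4)) ^ 2) *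
        Real.exp (δ₁ / 2 * 2) * Lam D (δ₁ / 4)) / ((L : ℝ) ^ ε - 1), half_pos hδ₁, ?_, ?_⟩
  · intro ε hε0 _
    have hLε : 0 < (L : ℝ) ^ ε - 1 := by
      have := Real.one_lt_rpow hL1 hε0
      linarith
    have h1 := B4Sect5Proof.latticeConst_nonneg D (show 0 ≤ δ₁ / 4 by positivity)
    have h2 := Lam_nonneg D (show 0 < δ₁ / 4 by positivity)
    exact div_nonneg (by positivity) hLε.le
  · intro P hPd hPL k hk1 hkK
    subst hPd hPL
    have hcap : P.spacing k ^ 2 * (0 : ℝ) ≤ 0 := by rw [mul_zero]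
    exact H137 P rfl rfl (gpSetting P 1 0 k (L2Half.trivial P)) (compV P 1 0 k (L2Half.trivial P)) hk1 hkK hcap id
      (fun _ _ => rfl)

/-- Weakening the constant and the rate of a located leaf `Leaf235to237` of the concrete data (its distances are nonnegative;
the shape of the private `B5SecondOrderGpTorus.leaf235to237_mono`). [folklore] -/
private theorem leaf235to237_mono {P : Params} {S : B5.Setting} {cube : Site P 0 → S.Site → Prop}
    {comp : S.Loc → Fin P.d → (Site P 0 → ℝ)} {a msq c₀ c₀' δ δ' : ℝ} (hc₀ : 0 ≤ c₀) (hc : c₀ ≤ c₀') (hδ' : δ' ≤ δ)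
    (h : B5Ineq137.Leaf235to237 (scaleData P S (aux P S cube comp) a msq) P.L c₀ δ) :
    B5Ineq137.Leaf235to237 (scaleData P S (aux P S cube comp) a msq) P.L c₀' δ' := by
  obtain ⟨h0, hj⟩ := h
  refine ⟨fun μ ν x x' => ?_, fun j hj1 hjk => ?_⟩
  · exact decay_mono (mul_nonneg (pow_pos P.cast_L_pos _).le (distX_nonneg P S.k x x')) hc hc₀ hδ' (h0 μ ν x x')
  · obtain ⟨h1, h2, h3⟩ := hj j hj1 hjk
    exact ⟨fun μ x y => decay_mono (dXU_nonneg P j x y) hc hc₀ hδ' (h1 μ x y),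
      fun y y' => decay_mono (dUU_nonneg P j y y') hc hc₀ hδ' (h2 y y'),
      fun ν y x' => decay_mono (dXU_nonneg P j x' y) hc hc₀ hδ' (h3 ν y x')⟩

include hd hL in
/-- ★ **(1.113) IN PAIR FORM (`Ineq113At`) FOR G′_k AT EVERY LEVEL, UNIFORMLY**: one `δ > 0` and one constant function `C(α, ε) ≥ 0`
such that `B5Ineq113.Ineq113At (sdata 1 0 k _) α (C α) δ` holds for every volume, level `1 ≤ k ≤ m + K` and `0 ≤ α < 1` — the printed
road «(1.136) … applying the estimates (2.35)–(2.37) … The proof of (1.113) is similar» as kernel-checked by `B5Ineq113.ineq113At_of_display136`,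
fed exactly as in `B5SecondOrderGpTorus.entries_gpSetting`: (1.136) `display136_of_tower`, the located leaves (2.35)∕(2.37)
(`leaf235to237_torus`) and (2.36) (`leaf236_scaleData_torus`) at the merged rate, `RowZero`, geometry, row sums, norm facts, `|a_j| ≤ 1`.
[cite: Balaban1984PropagatorsI, (1.113) p.36, (1.135)–(1.137) pp.39–40; Balaban1983RegularityDecay, Lemma 2.4 (2.35)–(2.37) p.582] -/
theorem ineq113At_sdata : ∃ δ : ℝ, ∃ C : ℝ → ℝ → ℝ, 0 < δ ∧ (∀ α ε, 0 ≤ α → 0 < ε → α + ε < 1 → 0 ≤ C α ε) ∧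
    ∀ (P : Params), P.d = D → P.L = L → ∀ (k : ℕ), 1 ≤ k → k ≤ P.m + P.K → ∀ α : ℝ, 0 ≤ α → α < 1 →
      B5Ineq113.Ineq113At (sdata 1 0 k (L2Half.trivial P) (P := P)) α (C α) δ := by
  obtain ⟨δ₂, c₂, hδ₂, hc₂, Hleaf⟩ := leaf235to237_torus D L hd hL one_pos le_rfl 0
  obtain ⟨δ₃, hδ₃, H3⟩ := leaf236_scaleData_torus D L hd hL one_pos (0 : ℝ)
  have hL1 : (1 : ℝ) < (L : ℝ) := by exact_mod_cast hL.2
  -- c₁ = c₁(α), chosen from «for α < 1, there exists a constant c₁» (and 0, never used, outside 0 ≤ α < 1)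
  have hc₁f : ∀ α : ℝ, ∃ c₁ : ℝ, 0 ≤ c₁ ∧ (0 ≤ α → α < 1 → ∀ (P : Params), P.d = D → P.L = L →
      ∀ (msq' : ℝ), 0 ≤ msq' →
        ∀ (S : B5.Setting) (cube : Site P 0 → S.Site → Prop) (comp : S.Loc → Fin P.d → (Site P 0 → ℝ)),
          S.k ≤ P.m + P.K → P.spacing S.k ^ 2 * msq' ≤ 0 → ∀ δ : ℝ, 0 ≤ δ → δ ≤ δ₃ →
            B5Ineq113.Leaf236 (scaleData P S (aux P S cube comp) 1 msq') P.L α c₁ δ) := by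
    intro α
    by_cases hα : 0 ≤ α ∧ α < 1
    · obtain ⟨c₁, hc₁, h⟩ := H3 hα.1 hα.2
      exact ⟨c₁, hc₁, fun _ _ => h⟩
    · exact ⟨0, le_rfl, fun h0 h1 => absurd ⟨h0, h1⟩ hα⟩
  choose c₁ hc₁0 hc₁ using hc₁f
  set δ := min δ₂ δ₃ with hδdef
  have hδpos : 0 < δ := lt_min hδ₂ hδ₃
  have hδ4 : 0 < δ / 4 := div_pos hδpos (by norm_num)
  refine ⟨δ / 2, fun α ε => 4 * ((2 * (c₂ + (1 : ℝ) ^ 2 * c₂ ^ 3 *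
        (Real.exp (δ / 4) * B4Sect5Proof.latticeConst D (δ / 4)) ^ 2) +
      (1 : ℝ) ^ 2 * c₁ α * c₂ ^ 2 * (Real.exp (δ / 4) * B4Sect5Proof.latticeConst D (δ / 4)) ^ 2) *
        Real.exp (δ / 2 * (2 + 1)) * Lam D (δ / 4)) / ((L : ℝ) ^ ε - 1), half_pos hδpos, ?_, ?_⟩
  · intro α ε _ hε0 _
    have hLε : 0 < (L : ℝ) ^ ε - 1 := by
      have := Real.one_lt_rpow hL1 hε0
      linarith
    have h1 := B4Sect5Proof.latticeConst_nonneg D hδ4.le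
    have h2 := Lam_nonneg D hδ4
    have := hc₁0 α
    exact div_nonneg (by positivity) hLε.le
  · intro P hPd hPL k hk1 hkK α hα0 hα1
    subst hPd hPL
    set o := L2Half.trivial P
    have hcap : P.spacing k ^ 2 * (0 : ℝ) ≤ 0 := by rw [mul_zero]
    have hleaf : B5Ineq137.Leaf235to237 (sdata 1 0 k o (P := P)) P.L c₂ δ :=
      leaf235to237_mono hc₂ le_rfl (min_le_left _ _)
        (Hleaf P rfl rfl (gpSetting P 1 0 k o) (inCube P k) (compV P 1 0 k o) hkK hcap)
    have h236 : B5Ineq113.Leaf236 (sdata 1 0 k o (P := P)) P.L α (c₁ α) δ :=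
      hc₁ α hα0 hα1 P rfl rfl 0 le_rfl (gpSetting P 1 0 k o) (inCube P k) (compV P 1 0 k o) hkK hcap δ hδpos.le
        (min_le_right _ _)
    have G : B5Ineq137.Geometry (sdata 1 0 k o (P := P)) P.L 2 := geometry (cubeFacts_gpSetting 1 0 hkK o) 1 0
    have G' : B5Ineq113.Geometry113 (sdata 1 0 k o (P := P)) P.L :=
      B5Ineq110GpTorus.geometry113 (gpSetting P 1 0 k o) (inCube P k) (compV P 1 0 k o) 1 0
    have Rw : B5Ineq137.RowSums (sdata 1 0 k o (P := P)) P.L P.d (δ / 4)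
        (Real.exp (δ / 4) * B4Sect5Proof.latticeConst P.d (δ / 4)) (Lam P.d (δ / 4)) :=
      rowSums (S := gpSetting P 1 0 k o) (by show k ≤ P.m + P.K + 1; omega) hδ4 1 0
    have N : B5Ineq137.NormFacts (sdata 1 0 k o (P := P)) := normFacts 1 0
    have Z : B5Ineq113.RowZero (sdata 1 0 k o (P := P)) :=
      rowZero_scaleData (gpSetting P 1 0 k o) (aux P (gpSetting P 1 0 k o) (inCube P k) (compV P 1 0 k o)) 1 0
    have h136 : B5Ineq137.Display136 (sdata 1 0 k o (P := P)) P.L P.d :=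
      display136_of_tower P (gpSetting P 1 0 k o) _ one_pos le_rfl hk1
    have hā : ∀ j, |(sdata 1 0 k o (P := P)).a j| ≤ 1 := fun j => abs_aSeq_le one_pos hL1 j
    exact B5Ineq113.ineq113At_of_display136 _ P.L P.d c₂ (c₁ α) δ 2 1
      (Real.exp (δ / 4) * B4Sect5Proof.latticeConst P.d (δ / 4)) (Lam P.d (δ / 4)) α hL1 hc₂ (hc₁0 α) hδpos hα0
      hā h136 Z hleaf h236 G G' Rw N

end Family

/-! ## §2 The scalar readings: one direction, one function supported in a unit cube, every point -/

section Scalar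

variable {P : Params}

/-- `E1` is linear: it vanishes on the zero function. [cite: Balaban1984PropagatorsI, (1.110) p.35, bookkeeping] -/
theorem E1_zero (a msq : ℝ) (k : ℕ) (ν : Fin P.d) (x : Site P 0) : E1 P a msq k ν (fun _ => 0) x = 0 := by
  unfold E1
  have : (fun _ : Site P 0 => (0 : ℝ)) = 0 := rfl
  rw [this, Matrix.mulVec_zero, Pi.zero_apply, mul_zero]

/-- `(G′∇*J)(x) = (G′_k∂*_νf)(x)` for the single-component source. [cite: Balaban1984PropagatorsI, (1.110) p.35, bookkeeping] -/
theorem gDiv_single (a msq : ℝ) (k : ℕ) (ν : Fin P.d) (f : Site P 0 → ℝ) (x : Site P 0) :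
    gDiv P a msq k (Pi.single ν f) x = E1 P a msq k ν f x := by
  unfold gDiv
  rw [Finset.sum_eq_single ν]
  · rw [Pi.single_eq_same]
  · intro ν' _ hne
    rw [Pi.single_eq_of_ne hne]
    exact E1_zero a msq k ν' x
  · intro h; exact absurd (Finset.mem_univ ν) h

/-- `supN 0 = 0`. [folklore] -/
private theorem supN_zero : supN P (0 : Site P 0 → ℝ) = 0 := by
  apply le_antisymm
  · exact Finset.sup'_le _ _ fun x _ => by simp
  · exact supN_nonneg P _

/-- `|J| = |f|` bound for the single-component source: `supNormV (Pi.single ν f) ≤ supN f`. [cite: Balaban1984PropagatorsI, (1.108) p.35, bookkeeping] -/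
theorem supNormV_single_le (ν : Fin P.d) (f : Site P 0 → ℝ) : supNormV P (Pi.single ν f) ≤ supN P f := by
  refine Finset.sup'_le _ _ fun ν' _ => ?_
  by_cases h : ν' = ν
  · subst h
    rw [Pi.single_eq_same]
  · rw [Pi.single_eq_of_ne h, supN_zero]
    exact supN_nonneg P f

/-- the single-component source is supported in `Δ̃(y′)` when `f` is. [cite: Balaban1984PropagatorsI, (1.110) p.35 («supp J ⊂ Δ̃(y′)»), bookkeeping] -/
theorem suppIn_single {k : ℕ} (a msq : ℝ) (o : L2Half P) (ν : Fin P.d) {f : Site P 0 → ℝ} {y' : Site P k}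
    (hf : ∀ x, f x ≠ 0 → inCube P k x y') : (gpSetting P a msq k o).suppIn (Pi.single ν f) y' := by
  intro ν' x hx
  by_cases h : ν' = ν
  · subst h
    rw [Pi.single_eq_same] at hx
    exact hf x hx
  · rw [Pi.single_eq_of_ne h] at hx
    exact absurd rfl hx

/-- every fine site lies in the cube `Δ̃(y)` of its own block `y = blk k x` (`T_blk_le`). [cite: Balaban1984PropagatorsI, p.35 (the cubes Δ̃(y)), bookkeeping] -/
theorem inCube_blk {k : ℕ} (hk : k ≤ P.m + P.K) (x : Site P 0) : inCube P k x (blk P k x) := by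
  unfold inCube
  have h := T_blk_le P hk x
  linarith

variable (D L : ℕ) (hd : 1 ≤ D) (hL : Odd L ∧ 1 < L)
include hd hL

/-- ★ **(1.110)₃ AS A SCALAR KERNEL BOUND**: one `C > 0` with `|(G′_k∂*_νf)(x)| ≤ C|f|` for every volume (`P.d = D`, `P.L = L`), level
`1 ≤ k ≤ m + K`, direction `ν`, every `f` supported in a cube `Δ̃(y′)` and EVERY point `x` (the decay factor `e^{−δ|y−y′|} ≤ 1` of
(1.110) dropped; `x ∈ Δ̃(y(x))`). [cite: Balaban1984PropagatorsI, Prop. 1.2 (1.110) p.35, (1.135) p.39; Balaban1985BackgroundPropagators, Cor. 3.5 p.407] -/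
theorem abs_E1_le : ∃ C : ℝ, 0 < C ∧ ∀ (P : Params), P.d = D → P.L = L → ∀ (k : ℕ), 1 ≤ k → k ≤ P.m + P.K →
    ∀ (ν : Fin P.d) (f : Site P 0 → ℝ) (y' : Site P k), (∀ x, f x ≠ 0 → inCube P k x y') →
      ∀ x : Site P 0, |E1 P 1 0 k ν f x| ≤ C * supN P f := by
  obtain ⟨δ, C, hδ, hC, H⟩ := supEntry2_sdata D L hd hL
  refine ⟨C, hC, fun P hPd hPL k hk1 hkK ν f y' hf x => ?_⟩
  have hS := H P hPd hPL k hk1 hkK (Pi.single ν f) (blk P k x) y' (suppIn_single 1 0 _ ν hf)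
  rw [gpSetting_e_two, gpSetting_dist, gpSetting_supNorm] at hS
  have h1 : |E1 P 1 0 k ν f x| ≤ cubeSup P k (blk P k x) () (fun _ : Unit => gDiv P 1 0 k (Pi.single ν f)) := by
    rw [← gDiv_single 1 0 k ν f x]
    exact le_cubeSup () (fun _ : Unit => gDiv P 1 0 k (Pi.single ν f)) () (inCube_blk hkK x)
  have hexp : Real.exp (-(δ * T P k (blk P k x) y')) ≤ 1 := by
    rw [Real.exp_le_one_iff, neg_nonpos]
    exact mul_nonneg hδ.le (T_nonneg P k _ _)
  calc |E1 P 1 0 k ν f x| ≤ C * Real.exp (-(δ * T P k (blk P k x) y')) * supNormV P (Pi.single ν f) := h1.trans hS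
    _ ≤ C * 1 * supN P f := by
        refine mul_le_mul (mul_le_mul_of_nonneg_left hexp hC.le) (supNormV_single_le ν f) (supNormV_nonneg _) ?_
        exact mul_nonneg hC.le zero_le_one
    _ = C * supN P f := by rw [mul_one]

/-- ★ **(1.112) AS A SCALAR KERNEL BOUND**: one constant function `C(ε) ≥ 0` with `|(∂_μG′_k∂*_νf)(x)| ≤ C(ε)(‖f‖_ε + |f|)` for
`0 < ε < 1`, every volume, level `1 ≤ k ≤ m + K`, directions `μ, ν`, `f` supported in a cube `Δ̃(y′)` and EVERY `x`
(`B5Display136Torus.E` = ∂^ε_μG^ε_k∂^{εᵀ}_ν; `‖f‖_ε = holN P k ε f`, `|f| = supN P f`). [cite: Balaban1984PropagatorsI, Prop. 1.2 (1.112) p.36, (1.137) p.40; Balaban1985BackgroundPropagators, (3.44) p.398] -/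
theorem abs_E_le : ∃ C : ℝ → ℝ, (∀ ε, 0 < ε → ε < 1 → 0 ≤ C ε) ∧ ∀ (P : Params), P.d = D → P.L = L →
    ∀ (k : ℕ), 1 ≤ k → k ≤ P.m + P.K → ∀ ε : ℝ, 0 < ε → ε < 1 →
      ∀ (μ ν : Fin P.d) (f : Site P 0 → ℝ) (y' : Site P k), (∀ x, f x ≠ 0 → inCube P k x y') →
        ∀ x : Site P 0, |E P 1 0 k μ ν f x| ≤ C ε * (holN P k ε f + supN P f) := by
  obtain ⟨δ, C, hδ, hC, H⟩ := ineq137_sdata D L hd hL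
  refine ⟨C, hC, fun P hPd hPL k hk1 hkK ε hε0 hε1 μ ν f y' hf x => ?_⟩
  have h := H P hPd hPL k hk1 hkK ε μ ν f x (blk P k x) y' hε0 hε1 (Finset.mem_univ x) (inCube_blk hkK x)
    (fun z hz => hf z hz)
  have hexp : Real.exp (-(δ * T P k (blk P k x) y')) ≤ 1 := by
    rw [Real.exp_le_one_iff, neg_nonpos]
    exact mul_nonneg hδ.le (T_nonneg P k _ _)
  have hn : 0 ≤ holN P k ε f + supN P f := add_nonneg (holN_nonneg P k ε f) (supN_nonneg P f)
  calc |E P 1 0 k μ ν f x|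
      ≤ C ε * Real.exp (-(δ * T P k (blk P k x) y')) * (holN P k ε f + supN P f) := h
    _ ≤ C ε * 1 * (holN P k ε f + supN P f) :=
        mul_le_mul_of_nonneg_right (mul_le_mul_of_nonneg_left hexp (hC ε hε0 hε1)) hn
    _ = C ε * (holN P k ε f + supN P f) := by rw [mul_one]

/-- ★ **(1.113) AS A SCALAR PAIR BOUND**: one constant function `C(α, ε) ≥ 0` with
`|(∂_μG′_k∂*_νf)(x₁) − (∂_μG′_k∂*_νf)(x₂)| ≤ C(α,ε)(‖f‖_{α+ε} + |f|)·|x₁ − x₂|^α` for `x₁ ≠ x₂`, `|x₁ − x₂| ≤ 1` (η-units,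
`distX P k`), `0 ≤ α`, `0 < ε`, `α + ε < 1`, every volume, level, directions and `f` supported in a cube `Δ̃(y′)` (`Ineq113At` at
`x₁ ∈ Δ̃(y(x₁))`, decay factor dropped). [cite: Balaban1984PropagatorsI, Prop. 1.2 (1.113) p.36, p.40 («The proof of (1.113) is similar»); Balaban1985BackgroundPropagators, (3.45) p.398] -/
theorem abs_E_sub_E_le : ∃ C : ℝ → ℝ → ℝ, (∀ α ε, 0 ≤ α → 0 < ε → α + ε < 1 → 0 ≤ C α ε) ∧
    ∀ (P : Params), P.d = D → P.L = L → ∀ (k : ℕ), 1 ≤ k → k ≤ P.m + P.K →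
      ∀ α ε : ℝ, 0 ≤ α → 0 < ε → α + ε < 1 →
        ∀ (μ ν : Fin P.d) (f : Site P 0 → ℝ) (y' : Site P k), (∀ x, f x ≠ 0 → inCube P k x y') →
          ∀ x₁ x₂ : Site P 0, x₁ ≠ x₂ → distX P k x₁ x₂ ≤ 1 →
            |E P 1 0 k μ ν f x₁ - E P 1 0 k μ ν f x₂|
              ≤ C α ε * (holN P k (α + ε) f + supN P f) * distX P k x₁ x₂ ^ α := by
  obtain ⟨δ, C, hδ, hC, H⟩ := ineq113At_sdata D L hd hL
  refine ⟨C, hC, fun P hPd hPL k hk1 hkK α ε hα0 hε0 hαε μ ν f y' hf x₁ x₂ hne h1 => ?_⟩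
  have hα1 : α < 1 := by linarith
  have h := (H P hPd hPL k hk1 hkK α hα0 hα1 ε μ ν f x₁ x₂ (blk P k x₁) y' hε0 hαε (Finset.mem_univ x₁)
    (Finset.mem_univ x₂) hne h1 (inCube_blk hkK x₁) (fun z hz => hf z hz)).1
  have hexp : Real.exp (-(δ * T P k (blk P k x₁) y')) ≤ 1 := by
    rw [Real.exp_le_one_iff, neg_nonpos]
    exact mul_nonneg hδ.le (T_nonneg P k _ _)
  have hn : 0 ≤ holN P k (α + ε) f + supN P f := add_nonneg (holN_nonneg P k _ f) (supN_nonneg P f)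
  have hdα : 0 ≤ distX P k x₁ x₂ ^ α := Real.rpow_nonneg (distX_nonneg P k x₁ x₂) α
  calc |E P 1 0 k μ ν f x₁ - E P 1 0 k μ ν f x₂|
      ≤ C α ε * Real.exp (-(δ * T P k (blk P k x₁) y')) * (holN P k (α + ε) f + supN P f) * distX P k x₁ x₂ ^ α := h
    _ ≤ C α ε * 1 * (holN P k (α + ε) f + supN P f) * distX P k x₁ x₂ ^ α :=
        mul_le_mul_of_nonneg_right (mul_le_mul_of_nonneg_right
          (mul_le_mul_of_nonneg_left hexp (hC α ε hα0 hε0 hαε)) hn) hdα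
    _ = C α ε * (holN P k (α + ε) f + supN P f) * distX P k x₁ x₂ ^ α := by rw [mul_one]

end Scalar

end B9Ineq344TowerScalarEntries

end

end Literature.MathematicalPhysics.QuantumFieldTheory.Balaban1983to89
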